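import Literature.AnabelianGeometry.SemiGraphs.WitnessIwahoriOuterFinite
import Mathlib.GroupTheory.Commensurable
import Mathlib.NumberTheory.Padics.RingHoms
import HarnessLib

/-!
# The TRANSLATION CHARACTER of the Iwahori-type witness group `P = ℤ_p ⋊ (1 + pℤ_p)`: every automorphism
# of `P` acts on the characteristic translation subgroup `ℤ_p × 1` by a `p`-adic unit

Pure `ℤ_p`-algebra over abc-iut-w5-d236's `WitnessIwahoriGroup` and abc-iut-w6-d064's CLASSIFICATION of the
automorphisms of `P` (`WitnessIwahoriOuterFinite`: `Iw.mulEquiv_transl_a`, `Iw.isUnit_mulEquiv_lambda`,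
`Iw.mulEquiv_s_eq_zero_iff`, consumed BY NAME) — Mochizuki, *Semi-graphs of anabelioids*, Publ. RIMS **42** (2006),
Def. 2.4 (iv) p. 26: the vertex group `P` and the torus branch subgroup `T_0` of the Thm-3.7 witnesses
`IwahoriWitness.loopGraph p` / `doubleLoop p`. [cite: MochizukiSemiAnbd2006, Def 2.4 p.25-26]

PROOF-ONLY file (abc-iut cell, layer L3, T54 board, row «HEST@SEGMENT-CHARACTER», seat abc-iut-f-177 gen 9;
file (A) of two — file (B) `ArithTotalEstrangementDoubleLoopBranchTransport.lean` consumes the character to show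
that total arithmetic estrangement fails at the SEGMENT `doubleLoop p` for every outer action whose
`(p − 1)`-torsion characters have open kernels, in particular for `p = 2` outright).

* `SubgroupMulAut.*` — bookkeeping for images of subgroups under automorphisms / conjugations (§0
  «Topological Groups» conventions), shared with file (B);
* `Iw.exists_isUnit_mulEquiv_transl` — **the translation character of one automorphism** (re-packaging of
  w6-d064's classification): `θ (a, 1) = (λ_θ · a, 1)` for a UNIT `λ_θ ∈ ℤ_pˣ` (the translation subgroup
  `ℤ_p × 1` is characteristic);
* `Iw.one_zero_not_mem_commensurator` — the translation `(1, 1)` does not commensurate the torus `T_0`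
  (w6-d064's `Iw.relIndex_map_conj_transl_range_bHom`);
* `Iw.inv_transl_mul_bHom_mul_transl` — the re-alignment identity `(1,1)⁻¹ · (0, 1+ps) · (λ, 1) = (0, 1+ps)`
  when `(1 + p s) λ = 1`, and `Iw.exists_w_mul_eq_one_of_toZMod_eq_one` (`λ ≡ 1 (mod p)` ⇒ such an `s` exists);
* `Iw.exists_translationCharacter` — for a group `Γ` acting on a group `C` and an embedding `j : P ↪ C`, on the
  stabiliser `St ≤ Γ` of the pair `(j P, j T_0)` the units `λ` assemble into a CHARACTER `Λ : St → ℤ_pˣ` with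
  `γ · j(a, 1) = j(Λ(γ) a, 1)` (through the induced automorphism `θ_γ` of `P`, which preserves `T_0`);
* `Iw.map_realign_eq` — the subgroup identity consumed by file (B): when `Λ(γ) ≡ 1 (mod p)`, the automorphism
  `γ_{j(1,1)}⁻¹ ∘ γ_{j b_0(s)} ∘ Φ_γ ∘ γ_{j(1,1)}` fixes `j(T_0)`.

No definition, no new named fact; nothing here concerns the disputed corpus; no side is taken on
[IUTchIII] Cor. 3.12.
-/

noncomputable section

namespace Literature.AnabelianGeometry.SemiGraphs

/-! ### 0. Subgroup bookkeeping: images under automorphisms and conjugations ([SemiAnbd] §0 conventions) -/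

namespace SubgroupMulAut

variable {P : Type*} [Group P] {G : Type*} [Group G]

/-- `S.map (φ ψ) = (S.map ψ).map φ` for automorphisms `φ, ψ`. [cite: MochizukiSemiAnbd2006, §0 p.5] -/
theorem map_mul (φ ψ : MulAut G) (S : Subgroup G) :
    S.map (φ * ψ).toMonoidHom = (S.map ψ.toMonoidHom).map φ.toMonoidHom := by
  rw [Subgroup.map_map]; rfl

/-- The identity automorphism fixes every subgroup. [cite: MochizukiSemiAnbd2006, §0 p.5] -/
theorem map_one (S : Subgroup G) : S.map (1 : MulAut G).toMonoidHom = S := by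
  ext y; simp

/-- `S.map Φ = S` ⇒ `S.map Φ⁻¹ = S`. [cite: MochizukiSemiAnbd2006, §0 p.5] -/
theorem map_inv_of_map_eq {S : Subgroup G} {Φ : MulAut G} (h : S.map Φ.toMonoidHom = S) :
    S.map Φ⁻¹.toMonoidHom = S := by
  conv_lhs => rw [← h]
  rw [← map_mul, inv_mul_cancel]
  exact map_one S

/-- Conjugating by an element of `S` fixes `S` (`γ_h(S) = S` for `h ∈ S`). [cite: MochizukiSemiAnbd2006, §0 p.5] -/
theorem map_conj_of_mem {S : Subgroup G} {h : G} (hh : h ∈ S) :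
    S.map (MulAut.conj h).toMonoidHom = S := by
  ext y
  simp only [Subgroup.mem_map, MulEquiv.coe_toMonoidHom, MulAut.conj_apply]
  constructor
  · rintro ⟨z, hz, rfl⟩
    exact S.mul_mem (S.mul_mem hh hz) (S.inv_mem hh)
  · intro hy
    exact ⟨h⁻¹ * y * h, S.mul_mem (S.mul_mem (S.inv_mem hh) hy) hh, by group⟩

/-- If `χ = γ_x ∘ ψ` pointwise then `γ_x(ψ S) = χ S`. [cite: MochizukiSemiAnbd2006, §0 p.5] -/
theorem map_map_conj_eq_of_forall (ψ χ : P →* G) (x : G) (h : ∀ y, χ y = x * ψ y * x⁻¹)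
    (S : Subgroup P) : (S.map ψ).map (MulAut.conj x).toMonoidHom = S.map χ := by
  rw [Subgroup.map_map]
  congr 1
  ext y
  simp [MulAut.conj_apply, h y]

/-- If `χ = γ_x ∘ ψ` pointwise then `γ_x(ψ P) = χ P`. [cite: MochizukiSemiAnbd2006, §0 p.5] -/
theorem range_map_conj_eq_of_forall (ψ χ : P →* G) (x : G) (h : ∀ y, χ y = x * ψ y * x⁻¹) :
    ψ.range.map (MulAut.conj x).toMonoidHom = χ.range := by
  rw [MonoidHom.range_eq_map, MonoidHom.range_eq_map]
  exact map_map_conj_eq_of_forall ψ χ x h ⊤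

/-- `χ (x S x⁻¹) = χ(x) χ(S) χ(x)⁻¹`. [cite: MochizukiSemiAnbd2006, §0 p.5] -/
theorem map_map_conj_hom (χ : P →* G) (x : P) (S : Subgroup P) :
    (S.map (MulAut.conj x).toMonoidHom).map χ = (S.map χ).map (MulAut.conj (χ x)).toMonoidHom := by
  rw [Subgroup.map_map, Subgroup.map_map]
  congr 1
  ext y
  simp [MulAut.conj_apply, map_inv]

/-- If `Φ ∘ χ = χ ∘ θ` pointwise then `Φ (χ S) = χ (θ S)`. [cite: MochizukiSemiAnbd2006, §0 p.5] -/
theorem map_map_of_semiconj (χ : P →* G) (Φ : MulAut G) (θ : P ≃* P)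
    (h : ∀ y, Φ (χ y) = χ (θ y)) (S : Subgroup P) :
    (S.map χ).map Φ.toMonoidHom = (S.map θ.toMonoidHom).map χ := by
  rw [Subgroup.map_map, Subgroup.map_map]
  congr 1
  ext y
  exact h y

end SubgroupMulAut

namespace Iw

open IwahoriWitness

variable {p : ℕ} [Fact p.Prime]

/-! ### 1. The translation character of an automorphism of `P` -/

/-- `1 + p · 0 = 1`. [cite: MochizukiSemiAnbd2006, §2 p.23] -/
theorem w_zero : w p 0 = 1 := by simp [w]

/-- `(1 + p · 0)⁻¹ = 1`. [cite: MochizukiSemiAnbd2006, §2 p.23] -/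
theorem winv_zero : winv p 0 = 1 := by
  rw [winv, w_zero]; exact Ring.inverse_one _

/-- **The translation character of an automorphism.**  Every (abstract) automorphism `θ` of `P` acts on the
characteristic translation subgroup `ℤ_p × 1` through multiplication by a unit: `θ (a, 1) = (λ a, 1)`,
`λ ∈ ℤ_pˣ` — abc-iut-w6-d064's classification (`Iw.mulEquiv_transl_a`, `Iw.isUnit_mulEquiv_lambda`,
`Iw.mulEquiv_s_eq_zero_iff`) re-packaged. [cite: MochizukiSemiAnbd2006, Def 2.4(iv) p.26] -/
theorem exists_isUnit_mulEquiv_transl (θ : Iw p ≃* Iw p) :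
    ∃ l : ℤ_[p], IsUnit l ∧ ∀ a : ℤ_[p], θ ⟨a, 0⟩ = ⟨l * a, 0⟩ :=
  ⟨(θ ⟨1, 0⟩).a, isUnit_mulEquiv_lambda θ,
    fun a => Iw.ext (mulEquiv_transl_a θ a) ((mulEquiv_s_eq_zero_iff θ _).2 rfl)⟩

/-! ### 2. The translation `(1, 1)`, the torus, and the re-alignment identity -/

/-- **`(1, 1)` does not commensurate the torus** `T_0` (`(1,1) T_0 (1,1)⁻¹ = T_{−p}` meets `T_0` trivially and
`T_0` is infinite: abc-iut-w6-d064's `Iw.relIndex_map_conj_transl_range_bHom`).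
[cite: MochizukiSemiAnbd2006, Def 2.4(iv) p.26] -/
theorem one_zero_not_mem_commensurator :
    (⟨1, 0⟩ : Iw p) ∉ Subgroup.Commensurable.commensurator (bHom (0 : ℤ_[p])).toMonoidHom.range := by
  intro h
  rw [Subgroup.Commensurable.commensurator_mem_iff] at h
  exact h.1 (relIndex_map_conj_transl_range_bHom (p := p) 0)

/-- **Re-alignment identity**: if `(1 + p s) λ = 1` then `(1,1)⁻¹ · b_0(s) · (λ, 1) = b_0(s) ∈ T_0`.
[cite: MochizukiSemiAnbd2006, Def 2.4(iv) p.26] -/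
theorem inv_transl_mul_bHom_mul_transl {l s : ℤ_[p]} (h : w p s * l = 1) :
    ((⟨1, 0⟩ : Iw p)⁻¹ * bHom 0 ⟨s⟩ * ⟨l, 0⟩) = bHom 0 ⟨s⟩ := by
  have hinv : ((⟨1, 0⟩ : Iw p)⁻¹) = ⟨-1, 0⟩ := by
    ext <;> simp [inv_a, inv_s, winv_zero]
  rw [hinv]
  ext
  · simp only [mul_a, mul_s, bHom_a, bHom_s]
    unfold w at h ⊢
    linear_combination h
  · simp only [mul_s, bHom_s]; ring

/-- `λ ≡ 1 (mod p)` for a unit `λ` ⇒ `(1 + p s) λ = 1` for some `s`. [cite: MochizukiSemiAnbd2006, §2 p.23] -/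
theorem exists_w_mul_eq_one_of_toZMod_eq_one {l : ℤ_[p]ˣ} (h : PadicInt.toZMod (l : ℤ_[p]) = 1) :
    ∃ s : ℤ_[p], w p s * l = 1 := by
  have h' : PadicInt.toZMod ((l⁻¹ : ℤ_[p]ˣ) : ℤ_[p]) = 1 := by
    have hm := map_mul (PadicInt.toZMod (p := p)) ((l⁻¹ : ℤ_[p]ˣ) : ℤ_[p]) (l : ℤ_[p])
    rw [Units.inv_mul, map_one, h, mul_one] at hm
    exact hm.symm
  have hk : ((l⁻¹ : ℤ_[p]ˣ) : ℤ_[p]) - 1 ∈ RingHom.ker (PadicInt.toZMod (p := p)) := by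
    rw [RingHom.mem_ker, map_sub, map_one, h', sub_self]
  rw [PadicInt.ker_toZMod, PadicInt.maximalIdeal_eq_span_p, Ideal.mem_span_singleton] at hk
  obtain ⟨s, hs⟩ := hk
  refine ⟨s, ?_⟩
  have hw : w p s = ((l⁻¹ : ℤ_[p]ˣ) : ℤ_[p]) := by unfold w; linear_combination -hs
  rw [hw, Units.inv_mul]

/-! ### 3. The character on a stabiliser -/

section Character

variable {C : Type*} [Group C]

/-- An automorphism `Φ` of a group `C` stabilising the image of an embedding `j : P ↪ C` induces an
automorphism `θ` of `P`: `Φ ∘ j = j ∘ θ`. [cite: MochizukiSemiAnbd2006, §0 p.5] -/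
theorem exists_mulEquiv_of_map_range_eq (j : Iw p →* C) (hj : Function.Injective j) (Φ : MulAut C)
    (hH : j.range.map Φ.toMonoidHom = j.range) :
    ∃ θ : Iw p ≃* Iw p, ∀ y, Φ (j y) = j (θ y) := by
  classical
  have h1 : ∀ y, ∃ y', j y' = Φ (j y) := fun y => by
    have hy : Φ (j y) ∈ j.range.map Φ.toMonoidHom := ⟨j y, ⟨y, rfl⟩, rfl⟩
    rw [hH] at hy
    obtain ⟨y', hy'⟩ := hy
    exact ⟨y', hy'⟩
  have h2 : ∀ y, ∃ y', j y' = Φ.symm (j y) := fun y => by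
    have hy : j y ∈ j.range.map Φ.toMonoidHom := by rw [hH]; exact ⟨y, rfl⟩
    obtain ⟨z, ⟨y', rfl⟩, hz⟩ := hy
    refine ⟨y', ?_⟩
    rw [← hz]
    simp
  choose θf hθf using h1
  choose θg hθg using h2
  refine ⟨{ toFun := θf, invFun := θg, left_inv := ?_, right_inv := ?_, map_mul' := ?_ },
    fun y => (hθf y).symm⟩
  · intro y; apply hj; rw [hθg, hθf]; simp
  · intro y; apply hj; rw [hθf, hθg]; simp
  · intro y y'; apply hj; simp only [map_mul, hθf]

/-- If `Φ ∘ j = j ∘ θ` and `Φ` stabilises `j(S)` then `θ` stabilises `S`. [cite: MochizukiSemiAnbd2006, §0 p.5] -/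
theorem map_mulEquiv_eq_of_map_map_eq (j : Iw p →* C) (hj : Function.Injective j) (Φ : MulAut C)
    (θ : Iw p ≃* Iw p) (hθ : ∀ y, Φ (j y) = j (θ y)) (S : Subgroup (Iw p))
    (hS : (S.map j).map Φ.toMonoidHom = S.map j) : S.map θ.toMonoidHom = S := by
  apply Subgroup.map_injective hj
  rw [Subgroup.map_map]
  conv_rhs => rw [← hS, Subgroup.map_map]
  congr 1
  ext y
  exact (hθ y).symm

/-- **The translation character on a stabiliser.**  Let `Γ` act on a group `C` through `α : Γ → Aut(C)`,
`j : P ↪ C` an embedding, and `St ≤ Γ` a subgroup stabilising both `j(P)` and `j(T_0)`.  Then the units of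
`Iw.exists_isUnit_mulEquiv_transl` assemble into a homomorphism `Λ : St → ℤ_pˣ`: for `γ ∈ St` the induced
automorphism `θ_γ` of `P` (`α(γ) ∘ j = j ∘ θ_γ`) preserves `T_0` and acts on translations by `Λ(γ)`.
[cite: MochizukiSemiAnbd2006, Def 2.4(iv) p.26] -/
theorem exists_translationCharacter {Γ : Type*} [Group Γ] (α : Γ →* MulAut C)
    (j : Iw p →* C) (hj : Function.Injective j) (St : Subgroup Γ)
    (hSt : ∀ γ ∈ St, j.range.map (α γ).toMonoidHom = j.range ∧
      ((bHom (0 : ℤ_[p])).toMonoidHom.range.map j).map (α γ).toMonoidHom =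
        (bHom (0 : ℤ_[p])).toMonoidHom.range.map j) :
    ∃ Λ : St →* ℤ_[p]ˣ, ∀ γ : St, ∃ θ : Iw p ≃* Iw p, (∀ y, α γ (j y) = j (θ y)) ∧
      (bHom (0 : ℤ_[p])).toMonoidHom.range.map θ.toMonoidHom = (bHom (0 : ℤ_[p])).toMonoidHom.range ∧
      ∀ a : ℤ_[p], θ ⟨a, 0⟩ = ⟨(Λ γ : ℤ_[p]) * a, 0⟩ := by
  have hθ : ∀ γ : St, ∃ θ : Iw p ≃* Iw p, ∀ y, α γ (j y) = j (θ y) :=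
    fun γ => exists_mulEquiv_of_map_range_eq j hj (α γ) (hSt γ γ.2).1
  choose θ hθ using hθ
  have hl : ∀ γ : St, ∃ l : ℤ_[p]ˣ, ∀ a : ℤ_[p], θ γ ⟨a, 0⟩ = ⟨(l : ℤ_[p]) * a, 0⟩ := fun γ => by
    obtain ⟨l, hl, h⟩ := exists_isUnit_mulEquiv_transl (θ γ)
    exact ⟨hl.unit, h⟩
  choose l hl using hl
  have hcomp : ∀ (γ γ' : St) (y : Iw p), θ (γ * γ') y = θ γ (θ γ' y) := fun γ γ' y => hj (by
    rw [← hθ γ, ← hθ γ', ← hθ (γ * γ'), Subgroup.coe_mul, map_mul, MulAut.mul_apply])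
  refine ⟨MonoidHom.mk' l fun γ γ' => ?_, fun γ => ⟨θ γ, hθ γ, ?_, hl γ⟩⟩
  · ext
    have h := (hl (γ * γ') 1).symm.trans ((hcomp γ γ' ⟨1, 0⟩).trans (by rw [hl γ', hl γ]))
    have ha := congrArg Iw.a h
    simpa using ha
  · exact map_mulEquiv_eq_of_map_map_eq j hj (α γ) (θ γ) (hθ γ) _ (hSt γ γ.2).2

/-- **The re-alignment computation** behind the obstruction at the segment: if `Φ ∘ j = j ∘ θ` with
`θ(T_0) = T_0`, `θ(1, 1) = (λ, 1)` and `(1 + p s) λ = 1`, then the automorphism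
`γ_{j(1,1)}⁻¹ ∘ γ_{j b_0(s)} ∘ Φ ∘ γ_{j(1,1)}` stabilises `j(T_0)` (it carries it to `j` of the conjugate of
`T_0` by `(1,1)⁻¹ b_0(s) (λ,1) = b_0(s) ∈ T_0`). [cite: MochizukiSemiAnbd2006, Def 2.4(iv) p.26] -/
theorem map_realign_eq (j : Iw p →* C) (Φ : MulAut C) (θ : Iw p ≃* Iw p)
    (hθ : ∀ y, Φ (j y) = j (θ y))
    (hT : ((bHom (0 : ℤ_[p])).toMonoidHom.range).map θ.toMonoidHom = (bHom (0 : ℤ_[p])).toMonoidHom.range)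
    {l s : ℤ_[p]} (hl : θ ⟨1, 0⟩ = ⟨l, 0⟩) (hs : w p s * l = 1) :
    (((bHom (0 : ℤ_[p])).toMonoidHom.range).map j).map
        (MulAut.conj (j ⟨1, 0⟩⁻¹) * (MulAut.conj (j (bHom 0 ⟨s⟩)) * Φ) * MulAut.conj (j ⟨1, 0⟩)).toMonoidHom =
      ((bHom (0 : ℤ_[p])).toMonoidHom.range).map j := by
  rw [SubgroupMulAut.map_mul, SubgroupMulAut.map_mul, SubgroupMulAut.map_mul, ← SubgroupMulAut.map_map_conj_hom j ⟨1, 0⟩ _,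
    SubgroupMulAut.map_map_of_semiconj j Φ θ hθ _, SubgroupMulAut.map_map_conj_hom θ.toMonoidHom ⟨1, 0⟩ _, hT,
    ← SubgroupMulAut.map_map_conj_hom j (bHom 0 ⟨s⟩) _, ← SubgroupMulAut.map_map_conj_hom j (⟨1, 0⟩⁻¹) _, ← SubgroupMulAut.map_mul,
    ← SubgroupMulAut.map_mul, ← map_mul, ← map_mul, MulEquiv.coe_toMonoidHom, hl,
    inv_transl_mul_bHom_mul_transl hs,
    SubgroupMulAut.map_conj_of_mem (S := (bHom (0 : ℤ_[p])).toMonoidHom.range) (h := bHom 0 ⟨s⟩) ⟨⟨s⟩, rfl⟩]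

end Character

end Iw

end Literature.AnabelianGeometry.SemiGraphs
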